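import Mathlib
import Literature.AlgebraicGeometry.Resolution.CobordantGame
import Summits.ResolutionOfSingularities.ResolutionOfSingularities.Theorems.WeightedInvariantLocalWeightedDropGradedSliceWildConjMove

/-!
# `WeightedInvariant.LocalWeightedDrop`: the wild slice at rank `0`, part 3 — the CONJUGATION IDENTITY on the Frobenius cover and
# the ORBIT SUBSTITUTION intertwining the charts

Route `ResolutionOfSingularities/WeightedInvariant`, crux `LocalWeightedDrop` (stmt-ResolutionOfSingularities-8899).
[OURS · L1 W4.3] — res-type-099 (gen 13); (S3) `gradedWonBy_zero_of_slice_wild` (res-type-060 NAMING 10:55:26Z), continuation of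
`…GradedSliceWildConjMove`.  Nothing here is a statement of the manuscript under review on ladder RESOLUTION; not a verdict on
card A.  AI proof, weaker than expert review.

* §6 **`subst_frobFamily_subst_conjMove` — THE COMMUTATION LEMMA read on the cover**: if `G(…, y_v^q) = (1+y_v)ᵃ·(h ⊗ 1)(Tw_q)`
  (res-type-060's wild trivialization p524471) then `(G∘Θ)(…, y_v^q) = (1+y_v)ᵃ · (h∘θ)((1+y_v)^τ x)` for the conjugate move `Θ`
  of the slice move `θ`: on the cover, moving the successor by `Θ` = moving the slice by `θ`.
* §7 `orbitSubst` `𝒪 : (σ, z) ↦ (σ, (1+y_v)^{τ_m}(c'_m + z_m) − c'_m, …)` from the variables of a successor of the slice into those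
  of a successor of `G`: it INTERTWINES THE CHARTS (`subst_orbitSubst_cruxChart`:
  `chart^W_{c'}(x_m)(𝒪) = (1+y_v)^{τ_m}·chart^{(W,0)}_{(c',·)}(x_m)`), has zero constants and unipotent linear part, preserves
  `s ∤` (`not_X_dvd_subst_orbitSubst`, by killing `y_v` onto the cylinder) and reflects singularity
  (`not_singular_subst_orbitSubst`).
-/

set_option linter.dupNamespace false -- mandated namespace of this single-conjunct summit
set_option autoImplicit false

namespace Summit.ResolutionOfSingularities.ResolutionOfSingularities.Theorems

namespace GradedGame

open MvPowerSeries
open Literature.AlgebraicGeometry.Resolution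

variable {k : Type} [Field k]

/-! ## §6 The conjugation identity on the Frobenius cover -/

section Identity

variable {n : ℕ} {q : ℕ} {ρ τ : Fin (n + 1) → ℕ} {u : MvPowerSeries (Fin (n + 1 + 1)) k}
  {θ : Fin (n + 1) → MvPowerSeries (Fin (n + 1)) k}

/-- Constant coefficients survive a substitution with zero constant terms. [OURS · L1 W4.3] -/
theorem constantCoeff_subst_of_constantCoeff_zero {N : ℕ} {σ' : Type} (a : Fin N → MvPowerSeries σ' k)
    (ha : ∀ i, constantCoeff (a i) = 0) (f : MvPowerSeries (Fin N) k) :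
    constantCoeff (subst a f) = constantCoeff f := by
  classical
  rw [constantCoeff_subst (hasSubst_of_constantCoeff_zero ha), finsum_eq_single _ 0]
  · simp
  · intro d hd
    obtain ⟨i, hi⟩ : ∃ i, d i ≠ 0 := by
      by_contra h
      push Not at h
      exact hd (Finsupp.ext h)
    rw [map_finsuppProd]
    have : (constantCoeff (a i)) ^ (d i) = 0 := by rw [ha i, zero_pow hi]
    rw [Finsupp.prod, Finset.prod_eq_zero (Finsupp.mem_support_iff.mpr hi) (by simpa using this), smul_zero]

/-- **THE CONJUGATION IDENTITY**: if `G(…, y_v^q) = (1+y_v)ᵃ · (h ⊗ 1)(Tw)` with `Tw = ((1+y_v)^{ρ}x, y_v)` (the wild trivialization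
of res-type-060, p524471), then for the conjugate move `Θ` of a slice coordinate change `θ`:
**`(G∘Θ)(…, y_v^q) = (1+y_v)ᵃ · (h∘θ)((1+y_v)^{τ} x)`** — the cover sees the cylinder of the MOVED slice, diagonally rescaled.
[OURS · L1 W4.3] -/
theorem subst_frobFamily_subst_conjMove (hq : 0 < q)
    (hfrob : ((1 : MvPowerSeries (Fin (n + 1 + 1)) k) + X (Fin.last (n + 1))) ^ q = 1 + X (Fin.last (n + 1)) ^ q)
    (hu : ∀ A, coeff A u ≠ 0 → ∃ a : ℕ, A = Finsupp.single (Fin.last (n + 1)) a) (hu1 : u * (1 + X (Fin.last (n + 1))) = 1)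
    (hdiv : ∀ i d, coeff d (θ i) ≠ 0 → ρ i ≤ tauDeg τ d ∧ q ∣ tauDeg τ d - ρ i) (hθ0 : ∀ i, constantCoeff (θ i) = 0)
    (G : MvPowerSeries (Fin (n + 1 + 1)) k) (h : MvPowerSeries (Fin (n + 1)) k) (a : ℕ)
    (Tw : Fin (n + 1 + 1) → MvPowerSeries (Fin (n + 1 + 1)) k) (hTw0 : ∀ j, constantCoeff (Tw j) = 0)
    (hTw : ∀ i, Tw (Fin.castSucc i) = (1 + X (Fin.last (n + 1))) ^ (ρ i) * X (Fin.castSucc i))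
    (hG : subst (frobFamily (k := k) n q) G = (1 + X (Fin.last (n + 1))) ^ a * subst Tw (cylinder h)) :
    subst (frobFamily (k := k) n q) (subst (conjMove q ρ τ u θ) G) =
      (1 + X (Fin.last (n + 1))) ^ a * subst (scaleFam (k := k) τ) (subst θ h) := by
  have hΘ0 := constantCoeff_conjMove (q := q) (ρ := ρ) (τ := τ) (u := u) hθ0
  have hΘs : HasSubst (conjMove q ρ τ u θ) := hasSubst_of_constantCoeff_zero hΘ0
  have hFs := hasSubst_frobFamily (k := k) (n := n) q hq
  have hθs : HasSubst θ := hasSubst_of_constantCoeff_zero hθ0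
  have hTws : HasSubst Tw := hasSubst_of_constantCoeff_zero hTw0
  have hSc := hasSubst_scaleFam (k := k) τ
  -- the cover family, extended by the identity on `y_v`
  set Ψ : Fin (n + 1 + 1) → MvPowerSeries (Fin (n + 1 + 1)) k := Fin.snoc (coverFam ρ τ u θ) (X (Fin.last (n + 1))) with hΨdef
  have hΨlast : Ψ (Fin.last (n + 1)) = X (Fin.last (n + 1)) := by simp [hΨdef]
  have hΨcs : ∀ i, Ψ (Fin.castSucc i) = coverFam ρ τ u θ i := by intro i; simp [hΨdef]
  have hΨ0 : ∀ j, constantCoeff (Ψ j) = 0 := by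
    intro j
    refine Fin.lastCases ?_ (fun i => ?_) j
    · rw [hΨlast]; exact constantCoeff_X _
    · rw [hΨcs, coverFam, map_mul, constantCoeff_subst_eq_zero hSc (constantCoeff_scaleFam τ) (hθ0 i), mul_zero]
  have hΨs : HasSubst Ψ := hasSubst_of_constantCoeff_zero hΨ0
  have hfroblast : frobFamily (k := k) n q (Fin.last (n + 1)) = X (Fin.last (n + 1)) ^ q := by simp [frobFamily]
  have hfrobcs : ∀ i : Fin (n + 1), frobFamily (k := k) n q (Fin.castSucc i) = X (Fin.castSucc i) := by
    intro i; simp [frobFamily, (Fin.castSucc_lt_last i).ne]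
  -- `Θ(Frob) = Frob(Ψ)` componentwise
  have hcomp : (fun j => subst (frobFamily (k := k) n q) (conjMove q ρ τ u θ j)) = fun j => subst Ψ (frobFamily (k := k) n q j) := by
    funext j
    refine Fin.lastCases ?_ (fun i => ?_) j
    · rw [subst_frobFamily_conjMove_last hq, hfroblast, subst_pow hΨs, subst_X hΨs, hΨlast]
    · rw [subst_frobFamily_conjMove_castSucc hq hfrob hu hu1 hdiv i, hfrobcs, subst_X hΨs, hΨcs]
  rw [subst_comp_subst_apply hΘs hFs, hcomp, ← subst_comp_subst_apply hFs hΨs, hG, subst_mul hΨs, subst_pow hΨs,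
    subst_add hΨs, subst_X hΨs, hΨlast, subst_comp_subst_apply hTws hΨs]
  have h1 : subst Ψ (1 : MvPowerSeries (Fin (n + 1 + 1)) k) = 1 := by rw [← coe_substAlgHom hΨs, map_one]
  rw [h1]
  congr 1
  -- the cylinder sees only the slice components
  have hfam0 : ∀ j, constantCoeff (subst Ψ (Tw j)) = 0 := fun j => constantCoeff_subst_eq_zero hΨs hΨ0 (hTw0 j)
  rw [subst_cylinder (hasSubst_of_constantCoeff_zero hfam0), subst_comp_subst_apply hθs hSc]
  congr 1
  funext i
  rw [hTw i, subst_mul hΨs, subst_pow hΨs, subst_add hΨs, h1, subst_X hΨs, subst_X hΨs, hΨlast, hΨcs, coverFam, ← mul_assoc,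
    ← mul_pow, mul_comm (1 + X _) u, hu1, one_pow, one_mul]

end Identity

/-! ## §7 No singular successor: transfer through the Frobenius cover and the orbit substitution -/

section Successor

variable {n : ℕ} (q : ℕ) (τ : Fin (n + 1) → ℕ) (W : Fin (n + 1) → ℕ) (c' : Fin (n + 1) → k)

/-- THE ORBIT SUBSTITUTION at an exceptional point `c'` of the slice move, weights `W`, scaling exponents `τ`: from the variables of
a successor of the slice (`σ, z_m`) into those of a successor of `G` (`σ, z_m, y_v`): `σ ↦ σ`,
`z_m ↦ (1+y_v)^{τ_m}(c'_m + z_m) − c'_m` (translated, `W_m > 0`) resp. `(1+y_v)^{τ_m} z_m`. [OURS · L1 W4.3] -/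
noncomputable def orbitSubst : Fin (n + 1 + 1) → MvPowerSeries (Fin (n + 1 + 1 + 1)) k :=
  Fin.cases (X 0) fun m => if 0 < W m then
      (1 + X (Fin.last (n + 1 + 1))) ^ (τ m) * (C (c' m) + X (Fin.castSucc m.succ)) - C (c' m)
    else (1 + X (Fin.last (n + 1 + 1))) ^ (τ m) * X (Fin.castSucc m.succ)

/-- The orbit substitution has zero constant terms. [OURS · L1 W4.3] -/
theorem constantCoeff_orbitSubst (J : Fin (n + 1 + 1)) : constantCoeff (orbitSubst (k := k) τ W c' J) = 0 := by
  refine Fin.cases ?_ (fun m => ?_) J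
  · simp [orbitSubst, constantCoeff_X]
  · simp only [orbitSubst, Fin.cases_succ]
    split_ifs <;> simp [constantCoeff_X]

/-- The orbit substitution is substitutable. [OURS · L1 W4.3] -/
theorem hasSubst_orbitSubst : HasSubst (orbitSubst (k := k) τ W c') := hasSubst_of_constantCoeff_zero (constantCoeff_orbitSubst τ W c')

/-- **THE ORBIT SUBSTITUTION INTERTWINES THE CHARTS**: `(1+y_v)^{τ_m} · chart^{(W,0)}_{(c',·)}(x_m) = (chart^{W}_{c'}(x_m))(𝒪)`.
[OURS · L1 W4.3] -/
theorem subst_orbitSubst_cruxChart (cb : Fin (n + 1 + 1) → k) (hc : ∀ m, cb (Fin.castSucc m) = c' m) (m : Fin (n + 1)) :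
    subst (orbitSubst (k := k) τ W c') (CobordantGame.cruxChart k W c' m) =
      (1 + X (Fin.last (n + 1 + 1))) ^ (τ m) * CobordantGame.cruxChart k (Fin.snoc W 0 : Fin (n + 1 + 1) → ℕ) cb (Fin.castSucc m) := by
  have hO := hasSubst_orbitSubst (k := k) τ W c'
  have hsucc : (Fin.castSucc m).succ = Fin.castSucc m.succ := (Fin.succ_castSucc m).symm
  unfold CobordantGame.cruxChart
  simp only [Fin.snoc_castSucc]
  by_cases hW : 0 < W m
  · rw [if_pos hW, if_pos hW, subst_mul hO, subst_pow hO, subst_add hO, subst_C, subst_X hO, subst_X hO, hc m, hsucc]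
    simp only [orbitSubst, Fin.cases_zero, Fin.cases_succ, if_pos hW]
    ring
  · rw [if_neg hW, if_neg hW, subst_X hO, hsucc]
    simp only [orbitSubst, Fin.cases_succ, if_neg hW]

/-- Killing the new frozen variable turns the orbit substitution into the cylinder embedding. [OURS · L1 W4.3] -/
theorem subst_kill_orbitSubst (J : Fin (n + 1 + 1)) :
    subst (Function.update (fun i => (X i : MvPowerSeries (Fin (n + 1 + 1 + 1)) k)) (Fin.last (n + 1 + 1)) 0)
      (orbitSubst (k := k) τ W c' J) = X (Fin.castSucc J) := by
  set κ := Function.update (fun i => (X i : MvPowerSeries (Fin (n + 1 + 1 + 1)) k)) (Fin.last (n + 1 + 1)) 0 with hκ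
  have hκ0 : ∀ i, constantCoeff (κ i) = 0 := by
    intro i
    by_cases hi : i = Fin.last (n + 1 + 1)
    · subst hi; simp [hκ]
    · rw [hκ, Function.update_of_ne hi]; exact constantCoeff_X i
  have hκs := hasSubst_of_constantCoeff_zero hκ0
  have h1 : subst κ (1 : MvPowerSeries (Fin (n + 1 + 1 + 1)) k) = 1 := by rw [← coe_substAlgHom hκs, map_one]
  have hκlast : κ (Fin.last (n + 1 + 1)) = 0 := by simp [hκ]
  have hκcs : ∀ i : Fin (n + 1 + 1), κ (Fin.castSucc i) = X (Fin.castSucc i) := by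
    intro i; simp [hκ, (Fin.castSucc_lt_last i).ne]
  refine Fin.cases ?_ (fun m => ?_) J
  · simp only [orbitSubst, Fin.cases_zero]
    rw [subst_X hκs]
    exact hκcs 0
  · simp only [orbitSubst, Fin.cases_succ]
    split_ifs with hW
    · simp only [subst_sub hκs, subst_mul hκs, subst_pow hκs, subst_add hκs, h1, subst_X hκs, hκlast, subst_C, hκcs]
      ring
    · simp only [subst_mul hκs, subst_pow hκs, subst_add hκs, h1, subst_X hκs, hκlast, hκcs]
      ring

/-- `σ ∤ h₁ ⇒ σ ∤ h₁(𝒪)` (kill `y_v`: `h₁(𝒪)` reduces to the cylinder of `h₁`). [OURS · L1 W4.3] -/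
theorem not_X_dvd_subst_orbitSubst {h₁ : MvPowerSeries (Fin (n + 1 + 1)) k} (hnd : ¬ X 0 ∣ h₁) :
    ¬ X 0 ∣ subst (orbitSubst (k := k) τ W c') h₁ := by
  rintro ⟨Q, hQ⟩
  set κ := Function.update (fun i => (X i : MvPowerSeries (Fin (n + 1 + 1 + 1)) k)) (Fin.last (n + 1 + 1)) 0 with hκ
  have hκ0 : ∀ i, constantCoeff (κ i) = 0 := by
    intro i
    by_cases hi : i = Fin.last (n + 1 + 1)
    · subst hi; simp [hκ]
    · rw [hκ, Function.update_of_ne hi]; exact constantCoeff_X i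
  have hκs := hasSubst_of_constantCoeff_zero hκ0
  have h := congrArg (subst κ) hQ
  rw [subst_comp_subst_apply (hasSubst_orbitSubst τ W c') hκs, subst_mul hκs, subst_X hκs] at h
  have hfam : (fun J => subst κ (orbitSubst (k := k) τ W c' J)) = fun J => (X (Fin.castSucc J) : MvPowerSeries (Fin (n + 1 + 1 + 1)) k) := by
    funext J; exact subst_kill_orbitSubst τ W c' J
  have hκ0' : κ 0 = X 0 := by
    have : (0 : Fin (n + 1 + 1 + 1)) ≠ Fin.last (n + 1 + 1) := by rw [← Fin.succ_last]; exact (Fin.succ_ne_zero _).symm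
    simp [hκ, this]
  rw [hfam, hκ0'] at h
  exact not_X_dvd_cylinder hnd ⟨_, h⟩

/-- Linear coefficients of the orbit substitution off the frozen column: the identity. [OURS · L1 W4.3] -/
theorem coeff_single_castSucc_orbitSubst (J J' : Fin (n + 1 + 1)) :
    coeff (Finsupp.single (Fin.castSucc J) 1) (orbitSubst (k := k) τ W c' J') = if J' = J then 1 else 0 := by
  have hne : ∀ i : Fin (n + 1 + 1), (Finsupp.single (Fin.castSucc i) 1 : Fin (n + 1 + 1 + 1) →₀ ℕ) ≠
      Finsupp.single (Fin.last (n + 1 + 1)) 1 := fun i h => (Fin.castSucc_lt_last i).ne ((Finsupp.single_left_inj one_ne_zero).mp h)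
  refine Fin.cases ?_ (fun m => ?_) J'
  · simp only [orbitSubst, Fin.cases_zero, coeff_X]
    by_cases hJ : (0 : Fin (n + 1 + 1)) = J
    · subst hJ; simp
    · rw [if_neg hJ, if_neg]
      intro h
      have h0 : (Fin.castSucc (0 : Fin (n + 1 + 1)) : Fin (n + 1 + 1 + 1)) = 0 := rfl
      rw [← h0] at h
      exact hJ (Fin.castSucc_injective _ ((Finsupp.single_left_inj one_ne_zero).mp h)).symm
  · simp only [orbitSubst, Fin.cases_succ]
    have hXm : coeff (Finsupp.single (Fin.castSucc J) 1) (X (Fin.castSucc m.succ) : MvPowerSeries (Fin (n + 1 + 1 + 1)) k) =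
        if m.succ = J then 1 else 0 := by
      rw [coeff_X]
      by_cases h : m.succ = J
      · subst h; simp
      · rw [if_neg h, if_neg]
        intro h'
        exact h (Fin.castSucc_injective _ ((Finsupp.single_left_inj one_ne_zero).mp h')).symm
    have hP1 : coeff (Finsupp.single (Fin.castSucc J) 1) ((1 + X (Fin.last (n + 1 + 1))) ^ (τ m) : MvPowerSeries (Fin (n + 1 + 1 + 1)) k) = 0 := by
      rw [coeff_single_one_add_X_pow, if_neg (Fin.castSucc_lt_last J).ne]
    have hC : coeff (Finsupp.single (Fin.castSucc J) 1) (C (c' m) : MvPowerSeries (Fin (n + 1 + 1 + 1)) k) = 0 := by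
      rw [coeff_C, if_neg (Finsupp.single_ne_zero.mpr one_ne_zero)]
    by_cases hW : 0 < W m
    · rw [if_pos hW, map_sub, coeff_single_one_mul_leibniz, constantCoeff_one_add_X_pow, one_mul, map_add, hC, zero_add, hXm,
        hP1, zero_mul, add_zero, sub_zero]
    · rw [if_neg hW, coeff_single_one_mul_leibniz, constantCoeff_one_add_X_pow, one_mul, hXm, hP1, zero_mul, add_zero]

/-- **THE ORBIT SUBSTITUTION REFLECTS SINGULARITY**: if `h₁ ∉ 𝔪²` then `h₁(𝒪) ∉ 𝔪²`. [OURS · L1 W4.3] -/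
theorem not_singular_subst_orbitSubst {h₁ : MvPowerSeries (Fin (n + 1 + 1)) k}
    (hns : ¬ (constantCoeff h₁ = 0 ∧ ∀ j, coeff (Finsupp.single j 1) h₁ = 0)) :
    ¬ (constantCoeff (subst (orbitSubst (k := k) τ W c') h₁) = 0 ∧
      ∀ j, coeff (Finsupp.single j 1) (subst (orbitSubst (k := k) τ W c') h₁) = 0) := by
  rintro ⟨h0, hlin⟩
  apply hns
  refine ⟨?_, fun J => ?_⟩
  · rwa [constantCoeff_subst_of_constantCoeff_zero _ (constantCoeff_orbitSubst τ W c')] at h0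
  · have h := hlin (Fin.castSucc J)
    rw [Literature.AlgebraicGeometry.Resolution.CobordantArc.coeff_degree_one_subst _ (constantCoeff_orbitSubst τ W c') h₁ _
      (Finsupp.degree_single _ _)] at h
    rw [Finset.sum_eq_single J] at h
    · rwa [coeff_single_castSucc_orbitSubst, if_pos rfl, mul_one] at h
    · intro J' _ hJ'
      rw [coeff_single_castSucc_orbitSubst, if_neg hJ', mul_zero]
    · intro hJ; exact absurd (Finset.mem_univ _) hJ

end Successor

end GradedGame

end Summit.ResolutionOfSingularities.ResolutionOfSingularities.Theorems
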